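import Literature.NumberTheory.GaloisRepresentations.LocalWeilDatum
import Mathlib.RingTheory.Norm.Transitivity
import HarnessLib

/-!
# The Weil datum of a non-archimedean local field, II: restriction to finite Galois levels and the norm dictionary `N_{K|F} = ∏_{W_F/(W_F ∩ G_K)}`

Continuation of `LocalWeilDatum.lean` (`W = W_F` acting on `A = (F^sep)ˣ`, fields
`fieldSubgroup F K = W_F ∩ G_K`).  Two pieces of Galois theory needed both for the arithmetic
axioms of the datum and for reading Neukirch's abstract reciprocity law (files
`AbstractReciprocityLaw*.lean`) in terms of Mathlib's Galois groups and norms: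

* `weilRestrict F L : W_F →* Gal(L/F)` for a normal `L ⊆ F̄`: its kernel is `W_F ∩ G_L`
  (`weilRestrict_eq_one_iff`) and it is **surjective** for finite `L` (`weilRestrict_surjective`:
  `W_F` is dense in `Γ_F` and `G_L` is open, so `W_F` meets every coset `σ G_L`,
  `exists_toAbsGalois_mem_smul_galFixing`), i.e. `W_F/(W_F ∩ G_L) ≅ G(L|F)`;
* the **norm dictionary**: for a finite separable `K ⊆ F̄` the cosets `W_F/(W_F ∩ G_K)` are in
  bijection with the `F`-embeddings `K → F̄` (`embOf`, `embOf_eq_embOf_iff`, `embOf_surjective`),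
  hence Neukirch's norm `N_{V|W}(a) = ∏_{ρ ∈ W/V} ρ a` (`AbstractCFT.norm (fieldSubgroup F K) ⊤ a`)
  of `a ∈ Kˣ` is the field norm: `coe_norm_fieldSubgroup_top` (`= algebraMap (Algebra.norm F a)`,
  by `Algebra.norm_eq_prod_embeddings`), and `normGroup (fieldSubgroup F K) ⊤` corresponds to
  `N_{K/F}(Kˣ) ≤ Fˣ` (`mem_normGroup_fieldSubgroup_top_iff`).

## References

* J. Neukirch, *Algebraic Number Theory*, Grundlehren 322, Springer 1999, Ch. IV §4 (p. 284:
  `N_{L|K} a = ∏_σ a^σ` over representatives of `G_K/G_L`), Ch. V §1 (p. 317). [NeukirchANT1999]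
* J. Tate, *Number theoretic background*, Corvallis 1979, (1.4.1) (`W_F` dense in `Γ_F`). [Corvallis1979]

## Mathlib reuse

`Algebra.norm_eq_prod_embeddings`, `AlgHom.liftNormal`, `AlgEquiv.restrictNormalHom(_surjective)`,
`Algebra.IsAlgebraic.algHom_bijective`, `DenseRange.exists_mem_open`, `Fintype.prod_bijective`.
-/

noncomputable section

open Field IsNonarchimedeanLocalField ValuativeRel
open scoped Pointwise

namespace Literature.NumberTheory.GaloisRepresentations

namespace LocalWeilDatum

open AbstractCFT

section Local

variable (F : Type*) [Field F] [ValuativeRel F] [TopologicalSpace F] [IsNonarchimedeanLocalField F]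

/-! ### `W_F` meets every coset of an open `G_K` -/

/-- `W_F` meets every coset `σ G_K` of the open subgroup `G_K` (`K/F` finite): `W_F` is dense in
`Γ_F`. [cite: Corvallis1979, (1.4.1)] -/
theorem exists_toAbsGalois_mem_smul_galFixing (K : IntermediateField F (AlgebraicClosure F))
    [FiniteDimensional F K] (σ : absoluteGaloisGroup F) :
    ∃ w : WeilGroup F,
      WeilGroup.toAbsGalois F w ∈ σ • (galFixing F K : Set (absoluteGaloisGroup F)) :=
  (WeilGroup.denseRange_toAbsGalois_holds F).exists_mem_open ((isOpen_galFixing F K).smul σ)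
    ⟨σ, Set.mem_smul_set.mpr ⟨1, (galFixing F K).one_mem, mul_one σ⟩⟩

/-! ### Restriction of `W_F` to a finite Galois level -/

/-- Restriction `W_F → G(L|F)` for a normal subextension `L ⊆ F̄` (through `W_F → Γ_F` and
`AlgEquiv.restrictNormalHom`). [cite: NeukirchANT1999, Ch. IV §4] -/
def weilRestrict (L : IntermediateField F (AlgebraicClosure F)) [Normal F L] :
    WeilGroup F →* (L ≃ₐ[F] L) :=
  ((AlgEquiv.restrictNormalHom L).comp (absoluteGaloisGroup.toAlgEquiv F).toMonoidHom).comp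
    (WeilGroup.toAbsGalois F)

/-- Unfolding lemma for `weilRestrict`. [folklore] -/
theorem weilRestrict_apply (L : IntermediateField F (AlgebraicClosure F)) [Normal F L]
    (w : WeilGroup F) : weilRestrict F L w =
      AlgEquiv.restrictNormalHom L (absoluteGaloisGroup.toAlgEquiv F (WeilGroup.toAbsGalois F w)) :=
  rfl

/-- `weilRestrict F L w` acts on `x ∈ L` as `w` does on `F̄`. [folklore] -/
theorem coe_weilRestrict_apply (L : IntermediateField F (AlgebraicClosure F)) [Normal F L]
    (w : WeilGroup F) (x : L) :
    ((weilRestrict F L w x : L) : AlgebraicClosure F) =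
      WeilGroup.toAbsGalois F w • (x : AlgebraicClosure F) := by
  rw [weilRestrict_apply, AlgEquiv.restrictNormalHom_apply, absoluteGaloisGroup.smul_def]

/-- The kernel of `W_F → G(L|F)` is `W_F ∩ G_L`. [cite: NeukirchANT1999, Ch. IV §4] -/
theorem weilRestrict_eq_one_iff (L : IntermediateField F (AlgebraicClosure F)) [Normal F L]
    {w : WeilGroup F} : weilRestrict F L w = 1 ↔ w ∈ fieldSubgroup F L := by
  rw [mem_fieldSubgroup_iff]
  constructor
  · intro h x hx
    have := congrArg (fun g : L ≃ₐ[F] L => ((g ⟨x, hx⟩ : L) : AlgebraicClosure F)) h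
    simpa [coe_weilRestrict_apply] using this
  · intro h
    ext x
    rw [coe_weilRestrict_apply, AlgEquiv.one_apply]
    exact h x x.2

/-- The kernel of `W_F → G(L|F)` as a subgroup. [cite: NeukirchANT1999, Ch. IV §4] -/
theorem ker_weilRestrict (L : IntermediateField F (AlgebraicClosure F)) [Normal F L] :
    (weilRestrict F L).ker = fieldSubgroup F L :=
  Subgroup.ext fun _ => weilRestrict_eq_one_iff F L

/-- **`W_F → G(L|F)` is surjective** for a finite normal `L ⊆ F̄`: lift `g` to `σ ∈ Γ_F`
(`restrictNormalHom_surjective`) and move inside the coset `σ G_L` to an element of the dense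
subgroup `W_F`. [cite: Corvallis1979, (1.4.1)] -/
theorem weilRestrict_surjective (L : IntermediateField F (AlgebraicClosure F)) [FiniteDimensional F L]
    [Normal F L] : Function.Surjective (weilRestrict F L) := by
  intro g
  obtain ⟨σ, hσ⟩ := AlgEquiv.restrictNormalHom_surjective (F := F) (K₁ := L)
    (E := AlgebraicClosure F) g
  set γ := (absoluteGaloisGroup.toAlgEquiv F).symm σ with hγ
  obtain ⟨w, hw⟩ := exists_toAbsGalois_mem_smul_galFixing F L γ
  obtain ⟨τ, hτ, hwτ⟩ := Set.mem_smul_set.mp hw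
  refine ⟨w, ?_⟩
  rw [← hσ]
  ext x
  rw [coe_weilRestrict_apply, ← hwτ, smul_eq_mul, mul_smul, (mem_galFixing_iff F).mp hτ _ x.2,
    AlgEquiv.restrictNormalHom_apply, hγ, absoluteGaloisGroup.toAlgEquiv_symm_apply]

/-- Compatibility of the restrictions in a tower `L ≤ L'` of normal subextensions: `w|_L` is
determined by `w|_{L'}`; phrased for arbitrary `γ ∈ Γ_F` with `γ|_{L'} = w|_{L'}`. [folklore] -/
theorem restrictNormalHom_eq_of_restrictNormalHom_eq {L L' : IntermediateField F (AlgebraicClosure F)}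
    [Normal F L] [Normal F L'] (hLL' : L ≤ L') {γ : absoluteGaloisGroup F} {w : WeilGroup F}
    (h : AlgEquiv.restrictNormalHom L' (absoluteGaloisGroup.toAlgEquiv F γ) = weilRestrict F L' w) :
    AlgEquiv.restrictNormalHom L (absoluteGaloisGroup.toAlgEquiv F γ) = weilRestrict F L w := by
  ext x
  have := congrArg (fun g : L' ≃ₐ[F] L' => ((g ⟨x, hLL' x.2⟩ : L') : AlgebraicClosure F)) h
  simp only [coe_weilRestrict_apply, AlgEquiv.restrictNormalHom_apply] at this
  rw [coe_weilRestrict_apply, AlgEquiv.restrictNormalHom_apply]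
  exact this

/-! ### Embeddings `K → F̄` and cosets `W_F / (W_F ∩ G_K)` -/

/-- The `F`-embedding `K → F̄` given by `w ∈ W_F` (restriction of the automorphism `w` of `F̄`).
[cite: NeukirchANT1999, Ch. IV §4 (p. 284)] -/
def embOf (K : IntermediateField F (AlgebraicClosure F)) (w : WeilGroup F) :
    K →ₐ[F] AlgebraicClosure F :=
  ((absoluteGaloisGroup.toAlgEquiv F (WeilGroup.toAbsGalois F w) :
      AlgebraicClosure F ≃ₐ[F] AlgebraicClosure F) : AlgebraicClosure F →ₐ[F] AlgebraicClosure F).comp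
    K.val

/-- `embOf K w x = w • x`. [folklore] -/
theorem embOf_apply (K : IntermediateField F (AlgebraicClosure F)) (w : WeilGroup F) (x : K) :
    embOf F K w x = WeilGroup.toAbsGalois F w • (x : AlgebraicClosure F) :=
  rfl

/-- Two elements of `W_F` give the same embedding of `K` iff they lie in the same coset of
`W_F ∩ G_K`. [cite: NeukirchANT1999, Ch. IV §4 (p. 284)] -/
theorem embOf_eq_embOf_iff {K : IntermediateField F (AlgebraicClosure F)} {w w' : WeilGroup F} :
    embOf F K w = embOf F K w' ↔ w⁻¹ * w' ∈ fieldSubgroup F K := by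
  rw [mem_fieldSubgroup_iff, AlgHom.ext_iff]
  simp only [embOf_apply, map_mul, map_inv, mul_smul, inv_smul_eq_iff]
  exact ⟨fun h x hx => (h ⟨x, hx⟩).symm, fun h x => (h x x.2).symm⟩

/-- **Every `F`-embedding `K → F̄` is induced by an element of `W_F`** (`K/F` finite): extend it
to an automorphism of `F̄` (`AlgHom.liftNormal`) and move inside its coset modulo the open `G_K`
to the dense `W_F`. [cite: Corvallis1979, (1.4.1)] -/
theorem embOf_surjective (K : IntermediateField F (AlgebraicClosure F)) [FiniteDimensional F K] :
    Function.Surjective (embOf F K) := by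
  intro ι
  let φ : AlgebraicClosure F →ₐ[F] AlgebraicClosure F := ι.liftNormal (AlgebraicClosure F)
  have hφ : ∀ x : K, φ x = ι x := fun x => by
    simpa using ι.liftNormal_commutes (AlgebraicClosure F) x
  let σ : AlgebraicClosure F ≃ₐ[F] AlgebraicClosure F :=
    AlgEquiv.ofBijective φ (Algebra.IsAlgebraic.algHom_bijective φ)
  have hσ : ∀ y, σ y = φ y := fun y => rfl
  set γ := (absoluteGaloisGroup.toAlgEquiv F).symm σ with hγ
  obtain ⟨w, hw⟩ := exists_toAbsGalois_mem_smul_galFixing F K γ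
  obtain ⟨τ, hτ, hwτ⟩ := Set.mem_smul_set.mp hw
  refine ⟨w, AlgHom.ext fun x => ?_⟩
  rw [embOf_apply, ← hwτ, smul_eq_mul, mul_smul, (mem_galFixing_iff F).mp hτ _ x.2, hγ,
    absoluteGaloisGroup.toAlgEquiv_symm_apply, hσ]
  exact hφ x

/-- The bijection `W_F/(W_F ∩ G_K) → (K →ₐ[F] F̄)`, on chosen representatives. [folklore] -/
theorem bijective_embOf_out (K : IntermediateField F (AlgebraicClosure F)) [FiniteDimensional F K] :
    Function.Bijective (fun q : (⊤ : Subgroup (WeilGroup F)) ⧸ (fieldSubgroup F K).subgroupOf ⊤ =>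
      embOf F K ((q.out : (⊤ : Subgroup (WeilGroup F))) : WeilGroup F)) := by
  constructor
  · intro q₁ q₂ h
    have h' := (embOf_eq_embOf_iff F).mp h
    rw [← QuotientGroup.out_eq' q₁, ← QuotientGroup.out_eq' q₂]
    exact QuotientGroup.eq.mpr (by rw [Subgroup.mem_subgroupOf]; exact h')
  · intro ι
    obtain ⟨w, rfl⟩ := embOf_surjective F K ι
    refine ⟨((⟨w, Subgroup.mem_top w⟩ : (⊤ : Subgroup (WeilGroup F))) : _ ⧸ _), ?_⟩
    apply (embOf_eq_embOf_iff F).mpr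
    have h := QuotientGroup.eq.mp (QuotientGroup.out_eq'
      (((⟨w, Subgroup.mem_top w⟩ : (⊤ : Subgroup (WeilGroup F))) :
        (⊤ : Subgroup (WeilGroup F)) ⧸ (fieldSubgroup F K).subgroupOf ⊤)))
    rw [Subgroup.mem_subgroupOf] at h
    exact h

/-! ### The norm dictionary -/

/-- The coercion `(F^sep)ˣ → F̄` as a monoid homomorphism. [folklore] -/
def coeHom : SepUnits F →* AlgebraicClosure F :=
  (algebraMap (SepClosure F) (AlgebraicClosure F) : SepClosure F →* AlgebraicClosure F).comp
    (Units.coeHom (SepClosure F))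

omit [ValuativeRel F] [TopologicalSpace F] [IsNonarchimedeanLocalField F] in
/-- Unfolding lemma for `coeHom`. [folklore] -/
@[simp]
theorem coeHom_apply (a : SepUnits F) :
    coeHom F a = ((a : SepClosure F) : AlgebraicClosure F) :=
  rfl

omit [ValuativeRel F] [TopologicalSpace F] [IsNonarchimedeanLocalField F] in
/-- A subfield of the separable closure is separable. [folklore] -/
theorem isSeparable_of_le_sepClosure {K : IntermediateField F (AlgebraicClosure F)}
    (hKs : K ≤ sepClosure F) : Algebra.IsSeparable F K :=
  (le_separableClosure_iff F (AlgebraicClosure F) K).mp hKs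

/-- **Neukirch's norm is the field norm**: for a finite separable `K ⊆ F̄` and `a ∈ Kˣ`,
`N_{V|W}(a) = ∏_{ρ ∈ W_F/(W_F ∩ G_K)} ρ a = N_{K/F}(a)` in `F̄`, `V = W_F ∩ G_K`
("`N_{L|K} a = ∏_σ a^σ`, `σ` running through a system of representatives of `G_K/G_L`").
[cite: NeukirchANT1999, Ch. IV §4 (p. 284)] -/
theorem coe_norm_fieldSubgroup_top (K : IntermediateField F (AlgebraicClosure F))
    [FiniteDimensional F K] (hKs : K ≤ sepClosure F) {a : SepUnits F}
    (ha : ((a : SepClosure F) : AlgebraicClosure F) ∈ K) :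
    coeHom F (norm (fieldSubgroup F K) ⊤ a) =
      algebraMap F (AlgebraicClosure F) (Algebra.norm F (⟨_, ha⟩ : K)) := by
  classical
  haveI := isSeparable_of_le_sepClosure F hKs
  haveI := finiteIndex_fieldSubgroup F K
  letI := Fintype.ofFinite ((⊤ : Subgroup (WeilGroup F)) ⧸ (fieldSubgroup F K).subgroupOf ⊤)
  rw [Algebra.norm_eq_prod_embeddings F (AlgebraicClosure F) (⟨_, ha⟩ : K), AbstractCFT.norm,
    finprod_eq_prod_of_fintype, map_prod]
  refine Fintype.prod_bijective _ (bijective_embOf_out F K) _ _ (fun q => ?_)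
  rw [coeHom_apply, coe_smul, embOf_apply]

/-- The norm of `a ∈ Kˣ` lies in (the image of) `F`: it is `N_{K/F}(a)`. [folklore] -/
theorem norm_fieldSubgroup_top_eq_algebraMap (K : IntermediateField F (AlgebraicClosure F))
    [FiniteDimensional F K] (hKs : K ≤ sepClosure F) {a : SepUnits F}
    (ha : ((a : SepClosure F) : AlgebraicClosure F) ∈ K) :
    (((norm (fieldSubgroup F K) ⊤ a : SepUnits F) : SepClosure F) : AlgebraicClosure F) =
      algebraMap F (AlgebraicClosure F) (Algebra.norm F (⟨_, ha⟩ : K)) :=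
  coe_norm_fieldSubgroup_top F K hKs ha

/-- The unit of `(F^sep)ˣ` attached to `x ∈ Fˣ`. [folklore] -/
def unitOf (x : Fˣ) : SepUnits F :=
  Units.map (algebraMap F (SepClosure F) : F →* SepClosure F) x

omit [ValuativeRel F] [TopologicalSpace F] [IsNonarchimedeanLocalField F] in
/-- `unitOf x` is `x` in `F̄`. [folklore] -/
@[simp]
theorem coe_unitOf (x : Fˣ) :
    (((unitOf F x : SepUnits F) : SepClosure F) : AlgebraicClosure F) =
      algebraMap F (AlgebraicClosure F) x := by
  simp [unitOf]

omit [ValuativeRel F] [TopologicalSpace F] [IsNonarchimedeanLocalField F] in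
/-- `unitOf` is injective. [folklore] -/
theorem unitOf_injective : Function.Injective (unitOf F) := by
  intro x y h
  have := congrArg (fun u : SepUnits F => ((u : SepClosure F) : AlgebraicClosure F)) h
  simp only [coe_unitOf] at this
  exact Units.ext ((algebraMap F (AlgebraicClosure F)).injective this)

/-- Elements of `F` are fixed by all of `W_F`: `unitOf x ∈ A^W`. [folklore] -/
theorem unitOf_mem_fixedBy (x : Fˣ) (U : Subgroup (WeilGroup F)) : unitOf F x ∈ fixedBy (SepUnits F) U := by
  intro w _
  apply Units.ext
  apply Subtype.ext
  rw [coe_smul, coe_unitOf]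
  exact ((absoluteGaloisGroup.toAlgEquiv F (WeilGroup.toAbsGalois F w)) :
    AlgebraicClosure F ≃ₐ[F] AlgebraicClosure F).commutes x

/-- **`A^W = Fˣ`**: every element of `A^{W_F}` is `unitOf x` for a unique `x ∈ Fˣ`. [folklore] -/
theorem exists_unitOf_eq_of_mem_fixedBy_top {a : SepUnits F}
    (ha : a ∈ fixedBy (SepUnits F) (⊤ : Subgroup (WeilGroup F))) : ∃ x : Fˣ, unitOf F x = a := by
  obtain ⟨x, hx⟩ := exists_algebraMap_eq_of_mem_fixedBy_top F ha
  have hx0 : x ≠ 0 := by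
    rintro rfl
    rw [map_zero] at hx
    exact (Units.ne_zero a) (Subtype.ext hx.symm)
  refine ⟨Units.mk0 x hx0, Units.ext (Subtype.ext ?_)⟩
  rw [coe_unitOf]
  exact hx

/-- **The norm group dictionary**: `x ∈ Fˣ` lies in `N_{V|W}(A^V)`, `V = W_F ∩ G_K`, iff it is a norm
from `Kˣ`. [cite: NeukirchANT1999, Ch. IV §4 (p. 284); Ch. V §1 (p. 317)] -/
theorem unitOf_mem_normGroup_iff (K : IntermediateField F (AlgebraicClosure F))
    [FiniteDimensional F K] (hKs : K ≤ sepClosure F) (x : Fˣ) :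
    unitOf F x ∈ normGroup (fieldSubgroup F K) ⊤ ↔
      x ∈ (Units.map (Algebra.norm F : K →* F)).range := by
  haveI := finiteIndex_fieldSubgroup F K
  rw [mem_normGroup_iff]
  constructor
  · rintro ⟨b, hb, hbx⟩
    have hbK := mem_of_mem_fixedBy_fieldSubgroup F hKs hb
    have hb0 : (⟨_, hbK⟩ : K) ≠ 0 := by
      intro h
      have : ((b : SepClosure F) : AlgebraicClosure F) = 0 := congrArg Subtype.val h
      exact (Units.ne_zero b) (Subtype.ext this)
    refine ⟨Units.mk0 _ hb0, Units.ext ?_⟩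
    apply (algebraMap F (AlgebraicClosure F)).injective
    rw [Units.coe_map, Units.val_mk0, ← norm_fieldSubgroup_top_eq_algebraMap F K hKs hbK,
      hbx, coe_unitOf]
  · rintro ⟨y, rfl⟩
    -- `b` = the unit of `F^sep` given by `y ∈ Kˣ`
    have hys : ((y : K) : AlgebraicClosure F) ∈ sepClosure F := hKs (y : K).2
    have hy0 : (⟨_, hys⟩ : SepClosure F) ≠ 0 := by
      intro h
      have : ((y : K) : AlgebraicClosure F) = 0 := congrArg Subtype.val h
      exact y.ne_zero (Subtype.ext this)
    refine ⟨Units.mk0 _ hy0, mem_fixedBy_fieldSubgroup_of_mem F (y : K).2, ?_⟩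
    apply Units.ext; apply Subtype.ext
    rw [norm_fieldSubgroup_top_eq_algebraMap F K hKs (y : K).2, coe_unitOf, Units.coe_map]
    rfl

end Local

end LocalWeilDatum

end Literature.NumberTheory.GaloisRepresentations
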